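import Mathlib
import Literature.Analysis.FluidPDE.VectorCalculus
import Literature.Analysis.FluidPDE.AxisymmetricEuler
import Literature.Analysis.FluidPDE.SwirlTransportProofs
import Literature.Analysis.FluidPDE.LandauSolutions
import Literature.Analysis.FluidPDE.SverakLandauClassification
import Summits.NavierStokesRegularity.NavierStokesRegularity.Theorems.ThreadingFluxAzimuthalCartanDefs
import Summits.NavierStokesRegularity.NavierStokesRegularity.Theorems.ThreadingFluxAzimuthalCartanLandauBaseTools
import HarnessLib

/-!
# Crux `PoloidalLiouville` (stmt-NavierStokesRegularity-1222, W1), crux idea «azimuthal-cartan-test» (ns-idea-15 g10, V26),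
# V♯ `LandauVertexFlexibility`: the mirror test points and the tilts there

V♯ (sketch `Cruxes/PoloidalLiouville/AzimuthalCartanSketch.lean` v1.3b l.330; Defs twin `ThreadingFluxAzimuthalCartanDefs`) ends with
`¬ ∃ Ω, IsEquivariantOn landauTorus 0 J3 (δv − tilt landau2 0 Ω)`.  The obstruction for the explicit mode-2 witness of the crux note
`AzimuthalCartanVertexWitness.md` is evaluated at the two MIRROR points `q_s = (3s, 0, 4)`, `s = ±1`, of the centre circle of `landauTorus`
(`norm_q`, `q_mem_landauTorus`; `norm_ne_apply_two_of_mem_landauTorus`: torus points are off the axis ray, BY NAME).  The base side: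

★ `tilt_landau2_J3_apply_one` — for EVERY `Ω`, `(tilt landau2 0 (J₃Ω) (q_s))₁ = Ω₁/3`, the SAME at both mirror points (from the tree's
`DU(x)h = (P/2)h + ½(DP(x)h)x + (Dβ(x)h)e₂` (`fderiv_landauAxisField_apply`), `U = (P/2)x + βe₂` (`landauAxisField_eq`), `x₁ = (e₂)₁ =
(J₃Ω)₂ = 0` and `β(q_s) = 2/(2·5 − 4) = 1/3`; no value of `DP` enters).

The witness side (`(lieJ3 δv (q_s))₁ = −36·s`, of OPPOSITE signs at the two points) and the assembly with `LieTilt.lieJ3_of_sub_tilt_equivariant`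
are the sequel bricks.  Pure calculus about Landau's explicit flow; `PoloidalLiouville` (1222), V♯ as a whole, W1 and NS regularity stay
OPEN / NOT proved.  `--supports stmt-NavierStokesRegularity-1222 --as helper`; 0 kit.  [folklore]
-/

-- the summit and its single problem share the name (D-0017 nested layout)
set_option linter.dupNamespace false

noncomputable section

open Set Function Metric
open scoped RealInnerProductSpace
open Literature.Analysis.FluidPDE

namespace Summit.NavierStokesRegularity.NavierStokesRegularity.Theorems.PoloidalLiouville.AzimuthalCartan

open Summit.NavierStokesRegularity.NavierStokesRegularity.Theorems
open Summit.NavierStokesRegularity.NavierStokesRegularity.Theorems.PoloidalLiouville.CentreJet (E3)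
open Summit.NavierStokesRegularity.NavierStokesRegularity.Theorems.LandauTail

namespace VertexWitness

/-! ### The two mirror test points `q_s = (3s, 0, 4)`, `s = ±1`, on the centre circle of `landauTorus` -/

/-- `|q_s| = 5`. [folklore] -/
theorem norm_q {s : ℝ} (hs : s = 1 ∨ s = -1) :
    ‖(EuclideanSpace.single 0 (3 * s) + EuclideanSpace.single 2 4 : E3)‖ = 5 := by
  have hs2 : s ^ 2 = 1 := by rcases hs with rfl | rfl <;> norm_num
  rw [EuclideanSpace.norm_eq, Fin.sum_univ_three]
  simp only [PiLp.add_apply, PiLp.single_apply]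
  simp only [Fin.isValue, ↓reduceIte, Fin.reduceEq, add_zero, zero_add, Real.norm_eq_abs, sq_abs]
  rw [show (3 * s) ^ 2 + (0 : ℝ) ^ 2 + 4 ^ 2 = 5 ^ 2 by nlinarith, Real.sqrt_sq (by norm_num)]

/-- `q_s ∈ landauTorus` (its axial coordinates are exactly the centre `(3, 4)` of the section disc). [folklore] -/
theorem q_mem_landauTorus {s : ℝ} (hs : s = 1 ∨ s = -1) :
    (EuclideanSpace.single 0 (3 * s) + EuclideanSpace.single 2 4 : E3) ∈ landauTorus := by
  show dist (Real.sqrt (‖(EuclideanSpace.single 0 (3 * s) + EuclideanSpace.single 2 4 : E3) - 0‖ ^ 2 -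
      (inner ℝ ((EuclideanSpace.single 0 (3 * s) + EuclideanSpace.single 2 4 : E3) - 0) (EuclideanSpace.single 2 1 : E3)) ^ 2 /
        ‖(EuclideanSpace.single 2 1 : E3)‖ ^ 2),
      inner ℝ ((EuclideanSpace.single 0 (3 * s) + EuclideanSpace.single 2 4 : E3) - 0) (EuclideanSpace.single 2 1 : E3) /
        ‖(EuclideanSpace.single 2 1 : E3)‖) ((3 : ℝ), (4 : ℝ)) < 1
  rw [sub_zero, norm_q hs, LandauBase.norm_e2]
  have hi : inner ℝ (EuclideanSpace.single 0 (3 * s) + EuclideanSpace.single 2 4 : E3) (EuclideanSpace.single 2 1 : E3) = 4 := by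
    rw [EuclideanSpace.inner_single_right]; simp
  rw [hi]
  have hs' : Real.sqrt ((5 : ℝ) ^ 2 - 4 ^ 2 / 1 ^ 2) = 3 := by
    rw [show ((5 : ℝ) ^ 2 - 4 ^ 2 / 1 ^ 2) = 3 ^ 2 by norm_num, Real.sqrt_sq (by norm_num)]
  rw [hs']
  norm_num

/-- Points of `landauTorus` (BY NAME) are off the axis ray: `|x| ≠ x₂`. [folklore] -/
theorem norm_ne_apply_two_of_mem_landauTorus {x : E3} (hx : x ∈ landauTorus) : ‖x‖ ≠ x 2 := by
  change dist (Real.sqrt (‖x - 0‖ ^ 2 - (inner ℝ (x - 0) (EuclideanSpace.single 2 1 : E3)) ^ 2 /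
      ‖(EuclideanSpace.single 2 1 : E3)‖ ^ 2), inner ℝ (x - 0) (EuclideanSpace.single 2 1 : E3) /
      ‖(EuclideanSpace.single 2 1 : E3)‖) ((3 : ℝ), (4 : ℝ)) < 1 at hx
  intro heq
  rw [Prod.dist_eq, sub_zero] at hx
  have h1 := (max_lt_iff.1 hx).1
  have hi : inner ℝ x (EuclideanSpace.single 2 1 : E3) = x 2 := by
    rw [EuclideanSpace.inner_single_right]; simp
  rw [hi, LandauBase.norm_e2, heq, one_pow, div_one, sub_self, Real.sqrt_zero, Real.dist_eq] at h1
  norm_num at h1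

/-! ### The tilts of the base at the mirror points -/

/-- **The tilts at the mirror points**: for every `Ω`, `(tilt U 0 (J₃ Ω) (q_s))₁ = Ω₁ · β(q_s) = Ω₁/3` — EVEN under the reflection
(`DU(x)h = (P/2)h + ½(DP h)x + (Dβ h)e₂`, and `x₁ = (e₂)₁ = (J₃Ω)₂ = 0`). [folklore] -/
theorem tilt_landau2_J3_apply_one {s : ℝ} (hs : s = 1 ∨ s = -1) (Ω : E3) :
    tilt landau2 0 (J3 Ω) (EuclideanSpace.single 0 (3 * s) + EuclideanSpace.single 2 4 : E3) 1 = Ω 1 / 3 := by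
  set x : E3 := EuclideanSpace.single 0 (3 * s) + EuclideanSpace.single 2 4 with hxdef
  have hr : ‖x‖ = 5 := norm_q hs
  have hx0 : x 0 = 3 * s := by simp [hxdef]
  have hx1 : x 1 = 0 := by simp [hxdef]
  have hx2 : x 2 = 4 := by simp [hxdef]
  have hx : x ≠ 0 := by
    intro h
    have := congrArg (fun v : E3 => v 2) h
    simp only [hx2, PiLp.zero_apply] at this
    norm_num at this
  have hJ : ∀ v : E3, J3 v = rotGen v := fun v => LandauBase.crossCLM_e2_apply v
  have hc1 : ∀ a b : E3, cross a b 1 = a 2 * b 0 - a 0 * b 2 := fun a b => by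
    simp [cross, cross_apply]
  have hax : ⟪(EuclideanSpace.single 2 1 : E3), x⟫ = 4 := by rw [EuclideanSpace.inner_single_left]; simp [hx2]
  simp only [tilt, sub_zero]
  show (cross (J3 Ω) (landauAxisField (EuclideanSpace.single 2 1) 2 x) -
      fderiv ℝ (landauAxisField (EuclideanSpace.single 2 1) 2) x (cross (J3 Ω) x)) 1 = Ω 1 / 3
  rw [fderiv_landauAxisField_apply LandauBase.norm_e2 LandauBase.one_lt_abs_two hx, landauAxisField_eq LandauBase.norm_e2
    LandauBase.one_lt_abs_two]
  simp only [PiLp.sub_apply, PiLp.add_apply, PiLp.smul_apply, smul_eq_mul, hc1, hJ, rotGen_apply_zero, rotGen_apply_two,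
    hx1, hx2, hax, hr, PiLp.single_apply]
  simp only [Fin.isValue, ↓reduceIte, Fin.reduceEq]
  ring

end VertexWitness

end Summit.NavierStokesRegularity.NavierStokesRegularity.Theorems.PoloidalLiouville.AzimuthalCartan
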